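import Summits.ValiantsHypothesis.ValiantsHypothesis.Theses.PolyaContinued

/-!
# Line `few-state-cut` of crux `MonotoneCoverHard` (stmt-ValiantsHypothesis-7421): the registered
stub `stub_fewStateCut` is FALSE AS STATED — degenerate case `n = 1`

Negative-lane lemma (val-width-7421-p2 g0, 2026-08-27).  The registered stub
`Cruxes.MonotoneCoverHard.FewStateCut.stub_fewStateCut` asks, uniformly in the cover, for a vertex
set `S` that is BALANCED for every weight-nonzero perfect matching `τ`: with `k(τ)` the number of
variable-labelled edges of `τ` having both endpoints in `S`, it demands `n ≤ 3 k(τ)` and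
`3 k(τ) ≤ 2 n`.  For `n = 1` the window `[n/3, 2n/3]` contains no integer, while the trivial cover
`m = 1`, `E = {(0,0)}`, `a (0,0) = X (0,0)` (signing `s ≡ 1`: a `1 × 1` determinant is its own
permanent) satisfies every hypothesis and HAS a weight-nonzero perfect matching (the identity).  Hence
no `S` exists and the stub fails at `(n, m) = (1, 1)` for every exponent `c`
(`stub_fewStateCut_false`).

CLASSIFICATION: misstated, not substantive.  The composition `MonotoneCoverHard_of` of the line only
invokes the stub at `n = 2^t` with `t = 4K² + 8K + 4 ≥ 4`, so the repaired stub — the same statement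
with the extra hypothesis `2 ≤ n` — composes verbatim; the witness below misses the repaired
statement (it has `n = 1`).  The repaired stub remains the line's open bet.  VP ≠ VNP is not moved by
this file; it records that the stub must be re-registered with `2 ≤ n →` before anyone proves it
"by name".
-/

namespace Summit.ValiantsHypothesis.ValiantsHypothesis.Theorems.MonotoneCoverHard.Negative

-- summit = sub-problem name (single-conjunct summit, D-0017 layout), so the namespace repeats it
set_option linter.dupNamespace false

open scoped Classical

/-- **The registered stub `stub_fewStateCut` (line `few-state-cut`, crux 7421) is false as stated.**
Witness: `n = m = 1`, `E = Finset.univ = {(0,0)}`, labels `a = MvPolynomial.X`, signing `s ≡ 1`.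
All three hypotheses hold (`det = permanent` for a `1 × 1` matrix; every label is a variable;
`per_1 = X (0,0) = aeval X (X (0,0))`), the identity is a weight-nonzero perfect matching, and its
balance constraint `1 ≤ 3k ∧ 3k ≤ 2` has no solution `k ∈ ℕ`.  Repaired statement (believed to be the
intended one, still open): add the hypothesis `2 ≤ n`; this witness has `n = 1` and misses it. -/
theorem stub_fewStateCut_false :
    ¬ (∃ c : ℕ, ∀ (n m : ℕ) (E : Finset (Fin m × Fin m))
      (a : Fin m × Fin m → MvPolynomial (Fin n × Fin n) ℂ),
      (∃ s : Fin m × Fin m → ℂ, (∀ e, s e = 1 ∨ s e = -1) ∧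
        (Matrix.of fun i j => if (i, j) ∈ E then MvPolynomial.C (s (i, j)) * MvPolynomial.X (i, j)
            else 0 : Matrix (Fin m) (Fin m) (MvPolynomial (Fin m × Fin m) ℂ)).det =
          (Matrix.of fun i j => if (i, j) ∈ E then MvPolynomial.X (i, j) else 0 :
            Matrix (Fin m) (Fin m) (MvPolynomial (Fin m × Fin m) ℂ)).permanent) →
      (∀ e, (∃ j, a e = MvPolynomial.X j) ∨ a e = 0 ∨ a e = 1) →
      Literature.Computability.AlgebraicComplexity.perPoly (Fin n) ℂ =
        MvPolynomial.aeval a (Matrix.of fun i j => if (i, j) ∈ E then MvPolynomial.X (i, j) else 0 :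
            Matrix (Fin m) (Fin m) (MvPolynomial (Fin m × Fin m) ℂ)).permanent →
      ∃ S : Finset (Fin m ⊕ Fin m),
        (∀ τ : Equiv.Perm (Fin m), (∀ i, (i, τ i) ∈ E ∧ a (i, τ i) ≠ 0) →
          n ≤ 3 * (Finset.univ.filter fun i : Fin m =>
              Sum.inl i ∈ S ∧ Sum.inr (τ i) ∈ S ∧ ∃ j, a (i, τ i) = MvPolynomial.X j).card ∧
          3 * (Finset.univ.filter fun i : Fin m =>
              Sum.inl i ∈ S ∧ Sum.inr (τ i) ∈ S ∧ ∃ j, a (i, τ i) = MvPolynomial.X j).card ≤ 2 * n) ∧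
        ((Finset.univ.filter fun τ : Equiv.Perm (Fin m) => ∀ i, (i, τ i) ∈ E ∧ a (i, τ i) ≠ 0).image
            (fun τ : Equiv.Perm (Fin m) => (Finset.univ.filter fun i : Fin m =>
              (Sum.inl i ∈ S ∧ Sum.inr (τ i) ∉ S) ∨ (Sum.inl i ∉ S ∧ Sum.inr (τ i) ∈ S)).image
                fun i => (i, τ i))).card ≤ 2 ^ ((Nat.log 2 m + c) ^ c)) := by
  rintro ⟨c, hc⟩
  -- the trivial cover of `per_1`
  have hsig : ∃ s : Fin 1 × Fin 1 → ℂ, (∀ e, s e = 1 ∨ s e = -1) ∧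
      (Matrix.of fun i j => if (i, j) ∈ (Finset.univ : Finset (Fin 1 × Fin 1)) then
          MvPolynomial.C (s (i, j)) * MvPolynomial.X (i, j) else 0 :
          Matrix (Fin 1) (Fin 1) (MvPolynomial (Fin 1 × Fin 1) ℂ)).det =
        (Matrix.of fun i j => if (i, j) ∈ (Finset.univ : Finset (Fin 1 × Fin 1)) then
            MvPolynomial.X (i, j) else 0 :
          Matrix (Fin 1) (Fin 1) (MvPolynomial (Fin 1 × Fin 1) ℂ)).permanent := by
    refine ⟨fun _ => 1, fun _ => Or.inl rfl, ?_⟩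
    rw [Matrix.det_unique, Matrix.permanent_unique]
    simp
  have hlab : ∀ e : Fin 1 × Fin 1,
      (∃ j, (MvPolynomial.X e : MvPolynomial (Fin 1 × Fin 1) ℂ) = MvPolynomial.X j) ∨
        (MvPolynomial.X e : MvPolynomial (Fin 1 × Fin 1) ℂ) = 0 ∨
        (MvPolynomial.X e : MvPolynomial (Fin 1 × Fin 1) ℂ) = 1 :=
    fun e => Or.inl ⟨e, rfl⟩
  have hper : Literature.Computability.AlgebraicComplexity.perPoly (Fin 1) ℂ =
      MvPolynomial.aeval (fun e : Fin 1 × Fin 1 => (MvPolynomial.X e : MvPolynomial (Fin 1 × Fin 1) ℂ))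
        (Matrix.of fun i j => if (i, j) ∈ (Finset.univ : Finset (Fin 1 × Fin 1)) then
            MvPolynomial.X (i, j) else 0 :
          Matrix (Fin 1) (Fin 1) (MvPolynomial (Fin 1 × Fin 1) ℂ)).permanent := by
    rw [Literature.Computability.AlgebraicComplexity.perPoly, Matrix.permanent_unique,
      Matrix.permanent_unique]
    simp [Matrix.mvPolynomialX]
  obtain ⟨S, hbal, -⟩ := hc 1 1 Finset.univ (fun e => MvPolynomial.X e) hsig hlab hper
  have hgood : ∀ i : Fin 1, (i, (1 : Equiv.Perm (Fin 1)) i) ∈ (Finset.univ : Finset (Fin 1 × Fin 1)) ∧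
      (MvPolynomial.X (i, (1 : Equiv.Perm (Fin 1)) i) : MvPolynomial (Fin 1 × Fin 1) ℂ) ≠ 0 :=
    fun i => ⟨Finset.mem_univ _, MvPolynomial.X_ne_zero _⟩
  obtain ⟨h1, h2⟩ := hbal 1 hgood
  have hk : (Finset.univ.filter fun i : Fin 1 =>
      Sum.inl i ∈ S ∧ Sum.inr ((1 : Equiv.Perm (Fin 1)) i) ∈ S ∧
        ∃ j, (MvPolynomial.X (i, (1 : Equiv.Perm (Fin 1)) i) : MvPolynomial (Fin 1 × Fin 1) ℂ) =
          MvPolynomial.X j).card ≤ 1 :=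
    (Finset.card_le_univ _).trans (by simp)
  omega

end Summit.ValiantsHypothesis.ValiantsHypothesis.Theorems.MonotoneCoverHard.Negative
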